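import Literature.RingTheory.Depth.CohenMacaulayFiniteOverRegular
import Literature.RingTheory.Depth.DepthFiniteExtension
import Literature.NumberTheory.GaloisRepresentations.NearlyOrdinaryPresentationProofs
import Literature.NumberTheory.GaloisRepresentations.AdequateOfCoprimeOrder
import Literature.NumberTheory.Automorphic.CDTTheorem722
import Literature.NumberTheory.EllipticCurves.WeilPairing
import HarnessLib

/-!
# STUB-IDEAS k2 (RESHAPE) — typed helper statements for `stub_liftThree`, generation 5

Companion of `STUB-IDEAS-stub_liftThree-2.md` (g5). Earlier k2 companions stay valid and are NOT
repeated: `STUB_IDEAS_stub_liftThree_2.lean` (ns `…StubIdeas2`: regime split `liftThree_of_regimes`,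
Plans A/B/C, DRS Criterion II, H7), `…_2g3.lean` (ns `…StubIdeas2g3`: E3 Brochard / de Smit),
`…_2g4.lean` (ns `…StubIdeas2g4`: regime-II road, E4 = Diamond Thm 2.4, E5 Σ-step arithmetic).

NEW RESHAPE (two techniques deep):
* (R1) **change the induction variable**: the minimal-level identity `R_∅ ≅ T_∅` is obtained not by
  the numerical criterion at level `∅` but by Fujiwara's axiomatisation of Taylor–Wiles patching —
  induction on the `3`-adic depth `m` of the auxiliary primes `q ≡ 1 (mod 3^m)` (Hida, *Modular forms
  and Galois cohomology*, Def. 3.34 + Thm. 3.35 (tw1)–(tw5), pp. 177–182 = Diamond, Invent. 128 (1997)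
  Thm. 2.1).
* (R2) **strengthen to simplify**: prove FREENESS of the patched module `L` over `R_∞` (stronger than
  `R = T`); freeness descends trivially modulo the augmentation ideal and makes `R_∅ → T_∅` injective
  for free (§A3). The new tool the reformulation admits is DEPTH THEORY, already in the tree:
  `isMaximalCohenMacaulayModule_iff_free_of_isRegularLocalRing` (Auslander–Buchsbaum over a regular
  local ring), `isCohenMacaulayModule_iff_of_finite` / `supportDim_eq_of_finite` (Bruns–Herzog
  Ex. 1.2.26: depth and dim do not see the finite change of rings), `ringKrullDim_quotient_add_one_le`,
  `NearlyOrdinaryPresentationCA.isRegularLocalRing_mvPowerSeries_dvr` (`𝒪⟦T₁…T_r⟧` regular of dim `r+1`).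
  §A types the whole OUTPUT HALF of Thm. 3.35 as three cycle-sized lemmas A1–A3 (all three PROVED
  here, kernel-checked) and the assembled limit-stage theorem A4 (sorried, recipe in its docstring).
* §C (declared cross-family tool, Family 3 "structural", used once): at `p = 3` EVERY residual-image
  input of the Taylor–Wiles machine (TW primes DDT Thm. 2.49, the `h⁰` terms of Wiles' Selmer formula,
  Schur `End_G(ρ̄) = 𝔽₃`, irreducibility over `ℚ(ζ_{3^n})`) follows from the single decidable fact
  `Q₈ ≤ im ρ̄` — which is what the stub's binder `ρ.IsAbsIrreducibleOverSqrt (-3)` MEANS for `E[3]`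
  (`det ρ̄ = χ̄₃`, tree `det_eq_modPCyclotomicCharacterZMod_of_exists_weilPairing`). C1a is PROVED by
  `decide`; C1b is the general "normal subgroup of invertible order with no invariants kills `H¹`".

Every `sorry` is a proposed helper lemma (sizes in the .md). Namespace is this file's own; nothing
here is imported by the skeleton.
-/

universe u

noncomputable section

open scoped MatrixGroups
open IsLocalRing Module Function
open Literature.RingTheory.Depth
open Literature.NumberTheory.GaloisRepresentations
open Literature.NumberTheory.Automorphic

namespace Summit.ABC.ABC.Cruxes.FreyModularity.StubIdeas2g5

/-! ## §A  Output half of the Taylor–Wiles-system theorem (Hida Thm. 3.35, proof p. 181 + Remark 3.36) -/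

section Engine

variable {A B : Type u} [CommRing A] [CommRing B] [Algebra A B]

/-- **A1 (F1, size S — PROVED).** Freeness climbs a module-finite tower of regular local rings of
equal dimension: if `L ≠ 0` is finite free over the regular local ring `A`, carries a compatible
`B`-module structure (`A → B → End L`), and `B` is regular local with `dim B = dim A`, then `L` is
free over `B`.  (Hida Remark 3.36: `depth_A L = dim A` ⇒ `depth_B L = dim B` ⇒ `hdim_B L = 0` by
Auslander–Buchsbaum.)  Here: `L` is maximal Cohen–Macaulay over `A`, hence over `B`
(Bruns–Herzog Ex. 1.2.26, tree `isCohenMacaulayModule_iff_of_finite`, `supportDim_eq_of_finite`),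
hence free (tree `isMaximalCohenMacaulayModule_iff_free_of_isRegularLocalRing`). -/
theorem free_of_free_of_ringKrullDim_eq [IsRegularLocalRing A] [IsRegularLocalRing B]
    (L : Type u) [AddCommGroup L] [Module A L] [Module B L] [IsScalarTower A B L]
    [Module.Finite A L] [Module.Free A L] [Nontrivial L]
    (hdim : ringKrullDim A = ringKrullDim B) : Module.Free B L := by
  haveI : Module.Finite B L := Module.Finite.of_restrictScalars_finite A B L
  have hA : IsMaximalCohenMacaulayModule A L :=
    (isMaximalCohenMacaulayModule_iff_free_of_isRegularLocalRing (S := A) L).2 ‹_›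
  have hB : IsMaximalCohenMacaulayModule B L := by
    refine ⟨(isCohenMacaulayModule_iff_of_finite (R := A) (S := B) L).2 hA.1, ?_⟩
    rw [← supportDim_eq_of_finite (R := A) (S := B) L, hA.2, hdim]
  exact (isMaximalCohenMacaulayModule_iff_free_of_isRegularLocalRing (S := B) L).1 hB

/-- **A2 (F2, size XS — PROVED).** Dimension forcing: a surjection from a domain of finite Krull dimension
onto a ring of the SAME dimension is an isomorphism (a non-zero kernel drops the dimension, tree
`Literature.RingTheory.KrullDimension.ringKrullDim_quotient_add_one_le`).  Used with
`B = 𝒪⟦T₁,…,T_r⟧ ↠ R̃_∞`, `dim R̃_∞ = dim 𝒪⟦S₁,…,S_r⟧ = r + 1` (Hida p. 181, top). [folklore] -/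
theorem ker_eq_bot_of_surjective_of_ringKrullDim_eq {B C : Type*} [CommRing B] [IsDomain B]
    [CommRing C] (f : B →+* C) (hf : Function.Surjective f)
    (htop : ringKrullDim B < ⊤) (hdim : ringKrullDim C = ringKrullDim B) :
    RingHom.ker f = ⊥ := by
  by_contra hne
  have h1 := Literature.RingTheory.KrullDimension.ringKrullDim_quotient_add_one_le hne
  have e : B ⧸ RingHom.ker f ≃+* C := RingHom.quotientKerEquivOfSurjective hf
  rw [ringKrullDim_eq_of_ringEquiv e, hdim] at h1
  have h0 : (0 : WithBot ℕ∞) ≤ ringKrullDim B := ringKrullDim_nonneg_of_nontrivial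
  have hne' : ringKrullDim B ≠ ⊥ := by
    intro hb
    rw [hb, le_bot_iff] at h0
    exact WithBot.coe_ne_bot h0
  obtain ⟨d, hd⟩ := WithBot.ne_bot_iff_exists.mp hne'
  rw [← hd] at h1 htop
  have hdtop : d ≠ ⊤ := by
    rintro rfl
    simp at htop
  obtain ⟨n, rfl⟩ := ENat.ne_top_iff_exists.mp hdtop
  have h2 : ((n : ℕ∞) : WithBot ℕ∞) + 1 ≤ (n : ℕ∞) := h1
  have h3 : (n : ℕ∞) + 1 ≤ n := by exact_mod_cast h2
  exact lt_irrefl _ ((ENat.add_one_le_iff (ENat.coe_ne_top n)).mp h3)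

/-- **A3 (size XS — PROVED).** A non-zero free module is faithful: if the `R`-action on a free `R`-module
`M ≠ 0` factors through `π : R → T`, then `π` is injective.  This is how (tw5) + freeness of
`M_∅ = L/𝔞L` over `R_∅ = R_∞/𝔞R_∞` give `R_∅ ≅ T_∅` with NO numerical criterion and NO
Gorenstein/multiplicity-one input (Hida p. 181; Diamond 1997 Thm. 2.1). [folklore] -/
theorem injective_of_free_of_smul_eq {R T M : Type*} [CommRing R] [CommRing T] (π : R →+* T)
    [AddCommGroup M] [Module R M] [Module T M] [Module.Free R M] [Nontrivial M]
    (h : ∀ (r : R) (m : M), r • m = π r • m) : Function.Injective π := by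
  classical
  refine (injective_iff_map_eq_zero π).2 fun r hr => ?_
  have h0 : ∀ m : M, r • m = 0 := fun m => by rw [h, hr, zero_smul]
  let b := Module.Free.chooseBasis R M
  obtain ⟨i⟩ := b.index_nonempty
  have h2 : b.repr (r • b i) = Finsupp.single i r := by
    rw [map_smul, b.repr_self, Finsupp.smul_single_one]
  rw [h0 (b i), map_zero] at h2
  exact Finsupp.single_eq_zero.mp h2.symm

/-- **The patched stage** — the OUTPUT of Fujiwara patching (Hida pp. 178–181: `A = 𝒪⟦S₁,…,S_r⟧`
acting through the `Δ_m`'s, `B = 𝒪⟦T₁,…,T_r⟧` from (tw3), `R_∞ = lim R_{n,m(n)}`,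
`L = lim M_{m(n)}/I_n` finite free over `A` by axiom (1) of Def. 3.34) and the INPUT of the
algebra engine.  A `Prop`-valued record over data already in scope; existence of an instance for
`ρ̄_{W,3}` is the construction seat P0 of the .md (pigeonhole = Mathlib
`nonempty_sections_of_finite_inverse_system`). [cite: Hida2000MFG, Def. 3.34, Thm. 3.35] -/
structure PatchedStage (A B R : Type u) [CommRing A] [CommRing B] [CommRing R] [Algebra A R]
    (L : Type u) [AddCommGroup L] [Module A L] [Module R L] : Prop where
  tower : IsScalarTower A R L
  regularA : IsRegularLocalRing A
  regularB : IsRegularLocalRing B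
  isDomainB : IsDomain B
  dim_eq : ringKrullDim A = ringKrullDim B
  dim_lt_top : ringKrullDim B < ⊤
  cover : ∃ β : B →+* R, Function.Surjective β
  finite : Module.Finite A L
  free : Module.Free A L
  nontrivial : Nontrivial L

/-- **A4 (assembled limit stage, size M; Hida Thm. 3.35 proof p. 181 + Rem. 3.36).** From a patched
stage: `L` is free over `R_∞`, `R_∞` acts faithfully on `L`, and every surjection `B ↠ R_∞` is an
isomorphism (so `R_∞ ≅ 𝒪⟦T₁,…,T_r⟧`, whence `R_∅ = R_∞/𝔞` is a complete intersection).
Recipe: `R̃ :=` image of `R_∞` in `End_A L` is a finite torsion-free `A`-algebra containing `A`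
(`L` faithful over `A`), so `dim R̃ = dim A = dim B` (tree `ringKrullDim_eq_of_isIntegral`);
A2 forces `B ≅ R̃`, hence `B ≅ R_∞ ≅ R̃` regular; A1 gives freeness. -/
theorem PatchedStage.free_and_faithful {A B R : Type u} [CommRing A] [CommRing B] [CommRing R]
    [Algebra A R] {L : Type u} [AddCommGroup L] [Module A L] [Module R L]
    (h : PatchedStage A B R L) :
    Module.Free R L ∧ FaithfulSMul R L ∧
      ∀ β : B →+* R, Function.Surjective β → Function.Bijective β := by
  sorry

/-- **A3 applied (size XS given A3): `R_∅ ≅ T_∅` and `M_∅` free.**  If `M` is a non-zero free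
`R`-module whose `R`-action factors through the surjection `π : R ↠ T` (this is (tw5): `M_∅` is a
`T_∅`-module and `R_∅` acts through `R_∅ ↠ T_∅`), then `π` is bijective — PROVED from A3. -/
theorem bijective_of_free_of_smul_eq {R T M : Type*} [CommRing R] [CommRing T] (π : R →+* T)
    (hπ : Function.Surjective π) [AddCommGroup M] [Module R M] [Module T M] [Module.Free R M]
    [Nontrivial M] (h : ∀ (r : R) (m : M), r • m = π r • m) : Function.Bijective π :=
  ⟨injective_of_free_of_smul_eq π h, hπ⟩

/-- Instance check (in tree): `𝒪⟦T₁,…,T_r⟧` over a DVR is regular local of dimension `r + 1`, so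
`A = B = 𝒪⟦X₁…X_r⟧` satisfy the ring-theoretic fields of `PatchedStage`. -/
example (𝒪 : Type u) [CommRing 𝒪] [IsDomain 𝒪] [IsDiscreteValuationRing 𝒪] (r : ℕ) :
    IsRegularLocalRing (MvPowerSeries (Fin r) 𝒪) ∧
      ringKrullDim (MvPowerSeries (Fin r) 𝒪) = (r + 1 : ℕ) :=
  NearlyOrdinaryPresentationCA.isRegularLocalRing_and_ringKrullDim 𝒪 r

end Engine

/-! ## §C  `p = 3`: every residual-image input of the TW machine is `Q₈ ≤ im ρ̄` -/

section PThree

/-- `𝔽₃`. -/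
abbrev F₃ : Type := ZMod 3

/-- `i = (0 -1; 1 0)`, `j = (1 1; 1 -1)` in `M₂(𝔽₃)`: `i² = j² = -1`, `ij = -ji`. -/
def qiM : Matrix (Fin 2) (Fin 2) F₃ := !![0, -1; 1, 0]
/-- see `qiM`. -/
def qjM : Matrix (Fin 2) (Fin 2) F₃ := !![1, 1; 1, -1]

/-- `i`, `j` as elements of `GL₂(𝔽₃)` (inverse `= -` itself). -/
def qi : GL (Fin 2) F₃ := ⟨qiM, -qiM, by decide, by decide⟩
/-- see `qi`. -/
def qj : GL (Fin 2) F₃ := ⟨qjM, -qjM, by decide, by decide⟩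

/-- **`Q₈ ≤ GL₂(𝔽₃)`** — the quaternion group generated by `i, j`; it is `O₂(SL₂(𝔽₃))`, the
unique Sylow `2`-subgroup of `SL₂(𝔽₃)`, hence normal in `GL₂(𝔽₃)`. -/
def Q8 : Subgroup (GL (Fin 2) F₃) := Subgroup.closure {qi, qj}

/-- **C1a (decidable core — PROVED by `decide`).** A matrix commuting with `i` and `j` is scalar; a
trace-zero one is `0`: `(𝔤𝔩₂(𝔽₃))^{Q₈} = 𝔽₃ · 1` (Schur: `End_{Q₈}(𝔽₃²) = 𝔽₃`) and
`(𝔰𝔩₂(𝔽₃))^{Q₈} = 0`.  Entrywise form, `X = (a b; c d)`. -/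
theorem comm_qi_qj_scalar :
    ∀ a b c d : F₃,
      (-c = b ∧ -d = -a ∧ a = d ∧ b = -c) →            -- `iX = Xi`
      (a + c = a + b ∧ b + d = a - b ∧ a - c = c + d ∧ b - d = c - d) →   -- `jX = Xj`
      b = 0 ∧ c = 0 ∧ d = a := by
  decide

/-- C1a, trace-zero form: `(𝔰𝔩₂(𝔽₃))^{Q₈} = 0` (and the same for the `det`-twist, since
`det = 1` on `Q₈`). PROVED by `decide`. -/
theorem comm_qi_qj_traceZero_eq_zero :
    ∀ a b c d : F₃, a + d = 0 →
      (-c = b ∧ -d = -a ∧ a = d ∧ b = -c) →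
      (a + c = a + b ∧ b + d = a - b ∧ a - c = c + d ∧ b - d = c - d) →
      a = 0 ∧ b = 0 ∧ c = 0 ∧ d = 0 := by
  decide

/-- **C1b (size S, general group cohomology).** If `N ⊴ G` is finite of order invertible in `k`
and `V^N = 0`, then `H¹(G, V) = 0`: every inhomogeneous `1`-cocycle `f : G → V`
(`f(gh) = g·f(h) + f(g)`, the tree's convention in `cocycles₁_le_coboundaries₁_iff_forall`) is a
coboundary.  Proof: `f|_N` is a coboundary by averaging over `N` (tree
`MonomialAdequacy.exists_eq_sub_of_subgroup` with `K = ⊥ ≤ N`); subtract it, so `f|_N = 0`; then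
for `n ∈ N`, `f(g) = f(g · g⁻¹ng) = f(ng) = n·f(g)`, so `f(g) ∈ V^N = 0`.  (Inflation–restriction
`0 → H¹(G/N, V^N) → H¹(G,V) → H¹(N,V)`, Mathlib `groupCohomology.H1InfRes`, with both ends `0`.)
[folklore] -/
theorem exists_eq_sub_of_normal_of_invariants_eq_zero {k G V : Type*} [Field k] [Group G]
    [AddCommGroup V] [Module k V] (ρ : Representation k G V) (N : Subgroup G) [N.Normal]
    [Finite N] (hN : (Nat.card N : k) ≠ 0) (hinv : ∀ v : V, (∀ n ∈ N, ρ n v = v) → v = 0)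
    (f : G → V) (hf : ∀ g h, f (g * h) = ρ g (f h) + f g) :
    ∃ m : V, ∀ g, f g = ρ g m - m := by
  sorry

/-- **C1c (size S, decidable in principle).** `Q₈` has order `8` and is normal in `GL₂(𝔽₃)`. -/
theorem card_Q8_and_normal : Nat.card Q8 = 8 ∧ (Q8).Normal := by
  sorry

/-- **C2 (size S/M, finite group theory).** A subgroup of `SL₂(𝔽₃)` acting absolutely irreducibly
on `𝔽₃²` contains `Q₈` (the proper subgroups of `SL₂(𝔽₃)` not containing its normal Sylow
`2`-subgroup `Q₈` are cyclic, hence have a common eigenvector over `𝔽₉`).  Conversely `Q₈` acts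
absolutely irreducibly. [folklore] -/
theorem q8_le_of_isAbsIrreducible (H : Subgroup (GL (Fin 2) F₃))
    (hdet : H ≤ (Matrix.GeneralLinearGroup.det : GL (Fin 2) F₃ →* F₃ˣ).ker)
    (hirr : IsAbsIrreducible H.subtype) : Q8 ≤ H := by
  sorry

/-- **C2' (size XS).** `Q₈` has no quotient of order `3` and `SL₂(𝔽₃)/Q₈ ≅ C₃`,
`GL₂(𝔽₃)/Q₈ ≅ S₃`: a normal subgroup of `3`-power index of any `H ≥ Q₈` still contains `Q₈`.
(This is "ρ̄|_{ℚ(ζ_{3^n})} is absolutely irreducible", DDT p. 84, in `Q₈`-currency.) [folklore] -/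
theorem q8_le_of_normal_index_pow_three (H N : Subgroup (GL (Fin 2) F₃)) (hQ : Q8 ≤ H) (hN : N ≤ H)
    (hnorm : (N.subgroupOf H).Normal) (k : ℕ) (hidx : (N.subgroupOf H).index = 3 ^ k) : Q8 ≤ N := by
  sorry

/-- **C3 (size M, the dictionary lemma).** For the mod-`3` representation of an elliptic curve over
`ℚ`, "`ρ̄|_{ℚ(√-3)}` absolutely irreducible" MEANS `Q₈ ≤ im ρ̄`: `det ρ̄ = χ̄₃` (tree
`WeierstrassCurve.det_eq_modPCyclotomicCharacterZMod_of_exists_weilPairing`), `ker χ̄₃ = Γ_{ℚ(√-3)}`,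
so `ρ̄(Γ_{ℚ(√-3)}) = im ρ̄ ∩ SL₂(𝔽₃)`, and C2 applies. [folklore] -/
theorem q8_le_range_of_isAbsIrreducibleOverSqrt (W : WeierstrassCurve ℚ) [W.IsElliptic]
    (ρ : ModPGaloisRep ℚ (ZMod 3) 2) (hρ : W.IsTorsionGaloisRep 3 ρ)
    (hirr : ρ.IsAbsIrreducibleOverSqrt (-3)) :
    Q8 ≤ (ρ : Field.absoluteGaloisGroup ℚ →ₜ* GL (Fin 2) (ZMod 3)).toMonoidHom.range := by
  sorry

/-- **C4 (size S given C1a–c; the payoff = DDT Lemma 2.48 + the `ℓ = 3` branch of Thm. 2.49,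
and the `h⁰`-terms of Wiles' formula DDT Thm. 2.19).**  For every `G` with `Q₈ ≤ G ≤ GL₂(𝔽₃)`:
`H⁰(G, ad⁰) = 0` and `H¹(G, ad⁰) = 0` in the tree's currency (`Subgroup.adZeroRep`,
`groupCohomology.cocycles₁ ≤ coboundaries₁`).  The `det`-twisted module `ad⁰(1)` is handled by the
same proof (the twist is trivial on `Q₈ ⊆ SL₂`).  Inflation (`H1InfRes`, mono) carries the `H¹`
vanishing to `Gal(F₀/ℚ) =` projective image, which is what DDT p. 83–84 consume. -/
theorem adZero_cohomology_vanishing_of_q8_le (G : Subgroup (GL (Fin 2) F₃)) (hQ : Q8 ≤ G) :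
    (Subgroup.adZeroRep G).invariants = ⊥ ∧
      groupCohomology.cocycles₁ (Rep.of (Subgroup.adZeroRep G)) ≤
        groupCohomology.coboundaries₁ (Rep.of (Subgroup.adZeroRep G)) := by
  sorry

end PThree

end Summit.ABC.ABC.Cruxes.FreyModularity.StubIdeas2g5

end
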